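import Literature.MathematicalPhysics.QuantumFieldTheory.Balaban1983to89.B9Thm310CommutatorBound389B

/-!
# `Balaban1983to89.B9Thm310CommutatorBound389BMajorant` — T. Bałaban, *Propagators for lattice gauge theories in a background field*,
# Commun. Math. Phys. **99** (1985) 389–434 [Balaban1985BackgroundPropagators], Sect. C pp. 413–415, (3.105)–(3.107) with (3.89) p. 409: THE
# `Factors389.fac` SLOT OF THE THEOREM 3.10 GLUE for the factors `K(h_□)G_□h_□` of `R` — the block majorant `1[y ∈ S′_□]·θ·e^{−δ d(y,y′)}` of the
# conjugated remainder letter on the real coordinates of the BOND sector, `θ = M₂(Σ_j‖b_j‖)·θ₃₈₉ᴮ∕(L·M_h)`, for ANY bond cube letter obeying Thm 3.3's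
# value ∕ gradient entries (sub-row G-B9-LETTERS, module M5.7-est, file E′₃; the bond-sector twin of this seat's `B9Thm37CommutatorBound389Majorant`)

statement-level skeleton of published theorems with citation tags; proofs where landed; nothing here is a claim about the Yang–Mills mass gap

p. 414: «Δ_aG₀ = I − Σ_□K(h_□)G_□h_□ − … = I − R. (3.105) … The operator K(h_□)G_□h_□ satisfies the inequality (3.89), hence it is small»; p. 413: «An
operator R_α(X) … is localized in X, i.e. its kernel has a support in X × X, … and satisfies a bound of the type (3.89)»; p. 415: «For M sufficiently
large … G = Σ_ω R₀(X₀)R_{α₁}(X₁)·⋯·R_{αₙ}(Xₙ) (3.107)» — the glue is `B9Thm310Whole`, whose hypothesis schema `Factors389.fac` asks, per factor, for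
`HasMajorant (g := toB6 g R H) blk (R_a(U)) (fun y y′ ↦ if y ∈ SF a then θ₀·M⁻¹·e^{−δ₀ d(y,y′)} else 0)`.  THIS FILE serves that shape for the factors
`K(h_□)(U)G_□(U)h_□`, in the frame of def-Y's reading dictionary (real coordinates `conj b`, block map `(x, j) ↦ ιB(Δ(x₋))` on `FBondY i × ι`, geometry
`toB6 (geo9K i) Rr Hp`), from E′₂b's pointwise bound and E′₂a's output localisation.

## WHAT THIS FILE PROVES (THEOREMS only; 0 `def … : Prop`, 0 sorry)
* ★ `hasMajorant_conj_of_ball_boundB` — the bond-carrier twin of def-Y's `Node00.OpsYRead342.hasMajorant_conj_of_ball_bound` ([4] (2.51) through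
  coordinates): a ball bound `‖(T(J ⊗ E))(x)‖ ≤ W(y,y′)·|J|` for `‖E‖ ≤ 1`, `supp J ⊂ Δ(βy′)`, `x ∈ Δ(βy)` gives `conj b T` the block majorant
  `M₂(Σ_j‖b_j‖)·W` w.r.t. `(x, j) ↦ ιB(Δ(x₋))`.
* `smul_comm_of_eq_KhBY` (an ℝ-linear `Rl` agreeing with `Λ ↦ K(h_□)(U)(O(h_□Λ))` is ℂ-homogeneous).
* ★★ `hasMajorant_conj_of_bound389B` — **THE `fac` SLOT FOR `K(h_□)G_□h_□`**: under the hypotheses of E′₂b's `norm_KhBY_O_hTY_apply_le`, a real basis `b`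
  (coordinate bound `M₂`), an ℝ-linear `Rl` with `Rl Λ = K(h_□)(U)(O(h_□Λ))`, and ANY finset `S′` of index bonds containing every `a` whose carrier block
  `βa` lies within torus block distance `2ℓ + 6` of `supp h_□`:
  `HasMajorant (g := toB6 (geo9K i) Rr Hp) (fun p ↦ ιB (Δ(p.1₋))) (conj b Rl) (fun a a′ ↦ if a ∈ S′ then M₂(Σ_j‖b_j‖)·θ₃₈₉ᴮ∕(L·M_h)·e^{−δ d(a,a′)} else 0)`
  — print's «localized … and satisfies a bound of the type (3.89)» (off `S′` the letter VANISHES on the block: E′₂a's `exists_hT_ne_zero_near_of_KhBY_hTY_ne_zero`).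
HONEST SCOPE.  As E′₂b: the Thm-3.3 entries of the cube letter are HYPOTHESES; same rate `δ`; corner-free members; `η = |c_f|⁻¹`; the global holonomy defect
enters `θ₃₈₉ᴮ` as `δ_P·Lʲ`; the localisation sets `S′_□` are the `2ℓ + 6`-neighbourhoods of `supp h_□` in the torus block graph (their overlap count for
`B9Thm310Whole`'s static data is NOT computed here); the choice «M sufficiently large» and the Neumann series (3.106) are the glue's; nothing of Thm 3.10 ∕ 3.3
asserted; nothing continuum ∕ OS ∕ mass gap ∕ Clay; YM mass gap NOT proved by any of this (Track A conditional rung).  `--supports stmt-QuantumFields-19200`.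
Net new unproved facts: 0.
-/

noncomputable section

namespace Literature.MathematicalPhysics.QuantumFieldTheory.Balaban1983to89.B9Thm310CommutatorBound389BMajorant

open Node00
open B9Thm37CubeCoverCommutators (cutMulY hTY)
open B9Thm37CubeCoverCommutatorSizes (side_conditions)
open B9Eq3104CutoffCommutators (hBdY KhBY)
open B9Eq3104CommutatorSupport (exists_hT_ne_zero_near_of_KhBY_hTY_ne_zero)
open B9Thm310CommutatorBound389B (theta389B theta389B_nonneg b1_pos norm_KhBY_O_hTY_apply_le)
open B6KLevelCensusIndexV1 (KIdx)
open B6Ineq2142KLevelV1 (β)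
open B6GlobalChartV1 (blkV1)
open B6Geom246MultiLevelBox (bset blkOf)
open B6Geom246MultiLevelTorus (bondT)
open B6Cover236MultiLevelBlocks (cubes)
open B6RandomWalk (HasMajorant hasMajorant_mono)
open B9Thm34Ext (toB6)
open B9GeoNormsKLevelV1 (geo9K)
open B9Eq352DivFormLetters (conj conj_apply coordEquiv coordEquiv_symm_apply)
open B9Ineq349SiteComposite (norm_le_norm_mul_of_ball)
open Node00.OpsYRead342 (liftY_smul_right)
open B9Eq39Adjoint (R plaqU)
open B9Eq3104CommutatorSizesCurl (jIns)
open scoped Matrix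

variable {𝔸 : Type} [NormedRing 𝔸] [NormedAlgebra ℂ 𝔸] [CompleteSpace 𝔸]
variable {d ℓ : ℕ} {hd : 1 ≤ d + 1} {hL : Odd (ℓ + 1) ∧ 1 < ℓ + 1} {b₀ b₁ : ℝ}
variable {ι : Type} [Fintype ι]
variable (i : KIdx d ℓ hd hL b₀ b₁) (b : Module.Basis ι ℝ 𝔸)

section ReadCore

variable [Fintype (geo9K i).Site] {Rr : ℝ} {Hp : Prop}

omit [CompleteSpace 𝔸] in
/-- ★ **THE (2.51) READING THROUGH COORDINATES ON THE BOND CARRIER**: if `‖(T(J ⊗ E))(x)‖ ≤ W(y,y′)·|J|` for `‖E‖ ≤ 1`, `supp J ⊂ Δ(βy′)`, `x ∈ Δ(βy)`,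
then `conj b T` has the block majorant `M₂·(Σ_j‖b_j‖)·W` w.r.t. `(x, j) ↦ ιB(Δ(x₋))` (`ιB` a section of `β`) — def-Y's `hasMajorant_conj_of_ball_bound` with the
site block map `Δ(z)` replaced by the bond block map `Δ(x₋) = blkV1 x`. [cite: Balaban1984PropagatorsII, (2.51) p.232 («|(Tλ)(x)| ≤ K(y,y′)|λ|»); Balaban1985BackgroundPropagators, Thm 3.3 p.399] -/
theorem hasMajorant_conj_of_ball_boundB (T : Module.End ℝ (FBondY i → 𝔸)) (hT : ∀ (c : ℂ) (Λ : FBondY i → 𝔸), T (c • Λ) = c • T Λ)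
    (ιB : BlkY i → IBondY i) (hι : ∀ s, β i.hN i.D i.hk (ιB s) = s)
    {M₂ : ℝ} (hM₂ : 0 ≤ M₂) (hrepr : ∀ (v : 𝔸) (j : ι), |b.repr v j| ≤ M₂ * ‖v‖)
    (W : IBondY i → IBondY i → ℝ) (hW : ∀ a a', 0 ≤ W a a')
    (hTW : ∀ (J : FBondY i → ℝ) (y y' : IBondY i), (geo9K i).suppIn (Sum.inr J) y' → ∀ E : 𝔸, ‖E‖ ≤ 1 →
      ∀ x : FBondY i, blkV1 i.hN i.D x = β i.hN i.D i.hk y → ‖T (liftY J E) x‖ ≤ W y y' * (geo9K i).supNorm (Sum.inr J)) :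
    HasMajorant (g := toB6 (geo9K i) Rr Hp) (fun p : FBondY i × ι => ιB (blkV1 i.hN i.D p.1)) (conj b T)
      (fun a a' => M₂ * (∑ j, ‖b j‖) * W a a') := by
  intro y' μv Bμ hμ p
  have hsupp : ∀ j : ι, (geo9K i).suppIn (Sum.inr (fun w : FBondY i => μv (w, j))) y' := by
    intro j w hw
    have h1 : ιB (blkV1 i.hN i.D w) = y' := by
      by_contra hne
      exact hw (hμ.off (w, j) hne)
    have h2 := congrArg (β i.hN i.D i.hk) h1
    rw [hι] at h2
    exact h2
  have hsupN : ∀ j : ι, (geo9K i).supNorm (Sum.inr (fun w : FBondY i => μv (w, j))) ≤ Bμ := by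
    intro j
    refine Real.iSup_le (fun w => ?_) hμ.nonneg
    by_cases hw : ιB (blkV1 i.hN i.D w) = y'
    · exact hμ.bound (w, j) hw
    · show |μv (w, j)| ≤ Bμ
      rw [hμ.off (w, j) hw, abs_zero]; exact hμ.nonneg
  have hΛ : (coordEquiv b).symm μv = ∑ j, liftY (fun w : FBondY i => μv (w, j)) (b j) := by
    funext w
    rw [coordEquiv_symm_apply, Finset.sum_apply]
    refine Finset.sum_congr rfl fun j _ => ?_
    rw [liftY_apply, Complex.coe_smul]
  have hpiece : ∀ j : ι, ‖T (liftY (fun w : FBondY i => μv (w, j)) (b j)) p.1‖ ≤ ‖b j‖ * (W (ιB (blkV1 i.hN i.D p.1)) y' * Bμ) := by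
    intro j
    refine norm_le_norm_mul_of_ball (fun E : 𝔸 => T (liftY (fun w : FBondY i => μv (w, j)) E) p.1) ?_ ?_ (b j)
    · intro c F
      show T (liftY (fun w : FBondY i => μv (w, j)) (c • F)) p.1 = c • T (liftY (fun w : FBondY i => μv (w, j)) F) p.1
      rw [liftY_smul_right, hT, Pi.smul_apply]
    · intro F hF
      have hz : blkV1 i.hN i.D p.1 = β i.hN i.D i.hk (ιB (blkV1 i.hN i.D p.1)) := (hι _).symm
      exact (hTW _ _ y' (hsupp j) F hF p.1 hz).trans (mul_le_mul_of_nonneg_left (hsupN j) (hW _ _))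
  rw [conj_apply, hΛ, map_sum, Finset.sum_apply]
  calc |b.repr (∑ j, T (liftY (fun w : FBondY i => μv (w, j)) (b j)) p.1) p.2|
      ≤ M₂ * ‖∑ j, T (liftY (fun w : FBondY i => μv (w, j)) (b j)) p.1‖ := hrepr _ _
    _ ≤ M₂ * ∑ j, ‖b j‖ * (W (ιB (blkV1 i.hN i.D p.1)) y' * Bμ) :=
        mul_le_mul_of_nonneg_left ((norm_sum_le _ _).trans (Finset.sum_le_sum fun j _ => hpiece j)) hM₂
    _ = M₂ * (∑ j, ‖b j‖) * W (ιB (blkV1 i.hN i.D p.1)) y' * Bμ := by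
        rw [← Finset.sum_mul]; ring

end ReadCore

/-- an ℝ-linear `Rl` agreeing with `Λ ↦ K(h_□)(U)(O(h_□Λ))` (three ℂ-linear maps) is ℂ-homogeneous. [cite: Balaban1985BackgroundPropagators, (3.104) p.414, bookkeeping] -/
theorem smul_comm_of_eq_KhBY (c : ↥(cubes i.D.toDomains)) (parB : BondParY 𝔸 i) (U : CfgY 𝔸 i) (O : (FBondY i → 𝔸) →ₗ[ℂ] (FBondY i → 𝔸))
    (Rl : Module.End ℝ (FBondY i → 𝔸)) (hRl : ∀ Λ, Rl Λ = KhBY i (hTY i c) parB U (O (cutMulY (hBdY i (hTY i c)) Λ))) (a : ℂ)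
    (Λ : FBondY i → 𝔸) : Rl (a • Λ) = a • Rl Λ := by
  rw [hRl, hRl, map_smul, map_smul, map_smul]

/-- the product-form bond test function `J ⊗ E` with `‖E‖ ≤ 1` has the profile of `J`. [cite: Balaban1985BackgroundPropagators, (3.39) p.397, bookkeeping] -/
theorem norm_liftY_le_abs (J : FBondY i → ℝ) {E : 𝔸} (hE : ‖E‖ ≤ 1) (w : FBondY i) : ‖liftY J E w‖ ≤ |J w| :=
  Node00.norm_liftY_le J ⟨E, mem_closedBall_zero_iff.2 hE⟩ w

section Majorant

variable [Fintype (geo9K i).Site] {Rr : ℝ} {Hp : Prop}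

/-- ★★ **THE `Factors389.fac` SLOT FOR THE FACTORS `K(h_□)G_□h_□` OF (3.105)** — for ANY bond cube letter `O` at `U` with Thm 3.3's value ∕ gradient entries
displayed (`h342₀`, `h342₁`, constants `B₀, δ`), E′₁'s displayed class constants, an ℝ-linear `Rl` with `Rl Λ = K(h_□)(U)(O(h_□Λ))`, a real basis `b`
(coordinate bound `M₂`) and any finset `S′` of index bonds containing every `a` whose carrier block lies within torus block distance `2ℓ + 6` of `supp h_□`:
the conjugated remainder letter `conj b Rl` has the block majorant `1[a ∈ S′]·M₂(Σ_j‖b_j‖)·θ₃₈₉ᴮ∕(L·M_h)·e^{−δ d(a,a′)}` w.r.t. `(x, j) ↦ ιB(Δ(x₋))` — print's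
«localized in X … and satisfies a bound of the type (3.89)», in the shape of `B9Thm310Whole.Factors389.fac`.
[cite: Balaban1985BackgroundPropagators, p.413, (3.105) p.414, (3.89) p.409, (3.107) p.415; Balaban1984PropagatorsII, (2.51) p.232] -/
theorem hasMajorant_conj_of_bound389B (c : ↥(cubes i.D.toDomains)) (parB : BondParY 𝔸 i) (U : CfgY 𝔸 i)
    (O : (FBondY i → 𝔸) →ₗ[ℂ] (FBondY i → 𝔸)) {B₀ δ : ℝ} (hB₀ : 0 ≤ B₀) (hδ : 0 ≤ δ)
    (hη : etaS i = |i.cf|⁻¹) (ιB : BlkY i → IBondY i) (hι : ∀ s, β i.hN i.D i.hk (ιB s) = s)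
    (hU : ∀ μ x, ‖(U μ x : 𝔸)‖ ≤ 1 ∧ ‖(((U μ x)⁻¹ : 𝔸ˣ) : 𝔸)‖ ≤ 1)
    (hT : ∀ (y : IBondY i) (f : FBondY i), ‖(qT i parB U y f : 𝔸)‖ ≤ 1 ∧ ‖(((qT i parB U y f)⁻¹ : 𝔸ˣ) : 𝔸)‖ ≤ 1)
    {δP ρ δK δI : ℝ} (hδP : 0 ≤ δP) (hρ : 0 ≤ ρ) (hδK : 0 ≤ δK) (hδI : 0 ≤ δI)
    (hP : ∀ (μ lam : Fin (d + 1)) (w : SiteY i) (Y : 𝔸), ‖R (plaqU (shiftY i) (UboxY i U) μ lam w) Y - Y‖ ≤ δP * ‖Y‖)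
    (hRe : ∀ p : PlaqY i, ‖reHolY i U p‖ ≤ ρ)
    (hKc : ∀ a e (μ : Fin (d + 1)) (x : SiteY i) (Z : 𝔸),
      ‖R (UboxY i U μ ((shiftY i μ).symm x))⁻¹ (jIns i U a e ((shiftY i μ).symm x) (R (UboxY i U μ ((shiftY i μ).symm x)) Z)) - jIns i U a e x Z‖
        ≤ δK * ‖Z‖)
    (hI : ∀ p : PlaqY i, ‖((i.cf ^ 2 : ℝ) : ℂ) • imHolY i U p‖ ≤ δI)
    (h342₀ : ∀ (J : FBondY i → ℝ) (y y' : IBondY i), (geo9K i).suppIn (Sum.inr J) y' →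
      ∀ Λ : FBondY i → 𝔸, (∀ x, ‖Λ x‖ ≤ |J x|) → ∀ x : FBondY i, blkV1 i.hN i.D x = β i.hN i.D i.hk y →
        ‖O Λ x‖ ≤ B₀ * (geo9K i).len y ^ 2 * Real.exp (-(δ * (geo9K i).dist y y')) * (geo9K i).supNorm (Sum.inr J))
    (h342₁ : ∀ (J : FBondY i → ℝ) (y y' : IBondY i), (geo9K i).suppIn (Sum.inr J) y' →
      ∀ Λ : FBondY i → 𝔸, (∀ x, ‖Λ x‖ ≤ |J x|) → ∀ (x : FBondY i) (ν : Fin (d + 1)), blkV1 i.hN i.D x = β i.hN i.D i.hk y →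
        ‖cdB i U ν (O Λ) x‖ ≤ B₀ * (geo9K i).len y * Real.exp (-(δ * (geo9K i).dist y y')) * (geo9K i).supNorm (Sum.inr J))
    {M₂ : ℝ} (hM₂ : 0 ≤ M₂) (hrepr : ∀ (v : 𝔸) (j : ι), |b.repr v j| ≤ M₂ * ‖v‖)
    (Rl : Module.End ℝ (FBondY i → 𝔸)) (hRl : ∀ Λ, Rl Λ = KhBY i (hTY i c) parB U (O (cutMulY (hBdY i (hTY i c)) Λ)))
    (S' : Finset (IBondY i))
    (hS' : ∀ a : IBondY i, (∃ u : SiteY i, hTY i c u ≠ 0 ∧ ((bondT i.D).dist (β i.hN i.D i.hk a) (blkOf i.D.toDomains u) : ℝ) ≤ 2 * (ℓ : ℝ) + 6) →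
      a ∈ S') :
    HasMajorant (g := toB6 (geo9K i) Rr Hp) (fun p : FBondY i × ι => ιB (blkV1 i.hN i.D p.1)) (conj b Rl)
      (fun a a' => if a ∈ S' then M₂ * (∑ j, ‖b j‖) * (theta389B d ℓ B₀ b₁ δ ρ δP δK δI c.1.1 / (((ℓ : ℝ) + 1) * i.Mh))
        * Real.exp (-(δ * (geo9K i).dist a a')) else 0) := by
  classical
  obtain ⟨_, hMh2, _, _⟩ := side_conditions i
  have hθ : ∀ a : IBondY i, 0 ≤ theta389B d ℓ B₀ b₁ δ ρ δP δK δI c.1.1 / (((ℓ : ℝ) + 1) * i.Mh) := fun a =>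
    div_nonneg (theta389B_nonneg d ℓ hB₀ (b1_pos i a).le hρ hδP hδK hδI δ _) (by positivity)
  -- the localised block bound `W`
  have hW : ∀ a a' : IBondY i,
      0 ≤ (if a ∈ S' then theta389B d ℓ B₀ b₁ δ ρ δP δK δI c.1.1 / (((ℓ : ℝ) + 1) * i.Mh) * Real.exp (-(δ * (geo9K i).dist a a')) else 0) :=
    fun a a' => by
      split_ifs
      · exact mul_nonneg (hθ a) (Real.exp_pos _).le
      · exact le_rfl
  have hTW : ∀ (J : FBondY i → ℝ) (y y' : IBondY i), (geo9K i).suppIn (Sum.inr J) y' → ∀ E : 𝔸, ‖E‖ ≤ 1 →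
      ∀ x : FBondY i, blkV1 i.hN i.D x = β i.hN i.D i.hk y → ‖Rl (liftY J E) x‖
        ≤ (if y ∈ S' then theta389B d ℓ B₀ b₁ δ ρ δP δK δI c.1.1 / (((ℓ : ℝ) + 1) * i.Mh) * Real.exp (-(δ * (geo9K i).dist y y')) else 0)
          * (geo9K i).supNorm (Sum.inr J) := by
    intro J y y' hs E hE x hx
    rw [hRl]
    by_cases hy : y ∈ S'
    · rw [if_pos hy]
      exact norm_KhBY_O_hTY_apply_le i c parB U O hB₀ hδ hη ιB hι hU hT hδP hρ hδK hδI hP hRe hKc hI h342₀ h342₁ J y y' hs (liftY J E)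
        (norm_liftY_le_abs i J hE) x hx
    · -- off `S′` the letter vanishes on the block `Δ(βy)` (output localisation, E′₂a)
      have h0 : KhBY i (hTY i c) parB U (O (cutMulY (hBdY i (hTY i c)) (liftY J E))) x = 0 := by
        by_contra hne
        obtain ⟨u, hu, hdist⟩ := exists_hT_ne_zero_near_of_KhBY_hTY_ne_zero i c parB U _ x hne
        rw [hx] at hdist
        exact hy (hS' y ⟨u, hu, hdist⟩)
      rw [h0, norm_zero, if_neg hy, zero_mul]
  have h := hasMajorant_conj_of_ball_boundB (Rr := Rr) (Hp := Hp) i b Rl (smul_comm_of_eq_KhBY i c parB U O Rl hRl) ιB hι hM₂ hrepr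
    (fun a a' => if a ∈ S' then theta389B d ℓ B₀ b₁ δ ρ δP δK δI c.1.1 / (((ℓ : ℝ) + 1) * i.Mh) * Real.exp (-(δ * (geo9K i).dist a a')) else 0)
    hW hTW
  refine hasMajorant_mono (g := toB6 (geo9K i) Rr Hp) _ h fun a a' => le_of_eq ?_
  show M₂ * (∑ j, ‖b j‖) * (if a ∈ S' then theta389B d ℓ B₀ b₁ δ ρ δP δK δI c.1.1 / (((ℓ : ℝ) + 1) * i.Mh)
      * Real.exp (-(δ * (geo9K i).dist a a')) else 0) = _
  split_ifs
  · ring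
  · rw [mul_zero]

end Majorant

end Literature.MathematicalPhysics.QuantumFieldTheory.Balaban1983to89.B9Thm310CommutatorBound389BMajorant

end
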